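import Summits.AtomisticToContinuum.HydrodynamicLimit.Theorems.EnskogAdjointDualityAdjointEnskogTestFamilyRSpatialTransfer
import Literature.Analysis.FluidPDE.BoltzmannEquation
import HarnessLib

/-!
# K2R refutation, part 2: the test-side operator on the hydrodynamic part `ψ = α + β·v + γ|v|²/2`

Route `EnskogAdjointDuality` of `AtomisticToContinuum/HydrodynamicLimit`, crux K2R
`AdjointEnskogTestFamilyR` (stmt-AtomisticToContinuum-11592), line `refutation` (c5 lead).

At a CONSTANT background (contact value `Y₀`, density `ρ₀`, Maxwellian `M = globalMaxwellian`) the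
pair increment of a quadratic test function `ψ(x, v) = α(x) + ⟪β(x), v⟫ + γ(x)|v|²/2` between the points
`x` and `y = x + εω` is `⟪β(y) − β(x), ω⟫ q + (γ(y) − γ(x))/2 · (⟪v,ω⟫² − ⟪w,ω⟫²)`, `q = ⟪v − w, ω⟫`
(`k2r_ref_psi_increment`); integrating against `q₊ Y₀ ρ₀ M(w) dw` gives
`Y₀ ρ₀ (⟪β(y) − β(x), ω⟫ P₂(⟪v,ω⟫) + (γ(y) − γ(x))/2 · P₃(⟪v,ω⟫))` with the half-Gaussian moments
`P₂(a) = ∫ (a−b)₊² φ₁(b) db`, `P₃(a) = ∫ (a−b)₊ (a²−b²) φ₁(b) db` (`k2r_ref_psi_bracket_integral`; the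
marginal identities enter as hypotheses, supplied by the stub `stub_halfGaussian`), and the Lipschitz
bound `|·| ≤ Y₀ρ₀ C dist(x,y) (|P₂| + |P₃|/2)` (`k2r_ref_psi_bracket_abs_le`).  Summing over impact
directions: `|∫_{S²} …| ≤ 4π Y₀ ρ₀ C ε (B₂ + B₃/2)` on any velocity ball where `|P₂| ≤ B₂`, `|P₃| ≤ B₃`
(`k2r_ref_psi_operator_abs_le`) — the `O(λ_N ε_N)` size of `L^N ψ` used by Step A of the refutation.

References: C. Cercignani, R. Illner, M. Pulvirenti, *The Mathematical Theory of Dilute Gases* (1994),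
§3.1 [CIP1994]; S. Chapman, T. G. Cowling (1970), §16 (collisional transfer).
-/

noncomputable section

open MeasureTheory Metric Set Filter Topology Function
open scoped InnerProductSpace

namespace Summit.AtomisticToContinuum.HydrodynamicLimit.Theorems.EnskogAdjointDuality

open Literature.Analysis.FluidPDE Literature.MathematicalPhysics.KineticTheory
open Literature.Analysis.FunctionSpaces

/-- **The pair increment of a quadratic test function.** For `ψ_c(v) = c.1 + ⟪c.2.1, v⟫ + c.2.2 |v|²/2`
and the elastic pair `v' = v − qω`, `w' = w + qω`, `q = ⟪v − w, ω⟫`, `‖ω‖ = 1`: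
`ψ_{cx}(v') + ψ_{cy}(w') − ψ_{cx}(v) − ψ_{cy}(w) = ⟪cy.2.1 − cx.2.1, ω⟫ q + (cy.2.2 − cx.2.2)/2 (⟪v,ω⟫² − ⟪w,ω⟫²)`
(collision invariance of `1, v, |v|²` at equal coefficients; `|v'|² − |v|² = ⟪w,ω⟫² − ⟪v,ω⟫²`).
[cite: CIP1994, §3.1] -/
theorem k2r_ref_psi_increment (cx cy : ℝ × V3 × ℝ) (v w : V3) (ω : sphere (0 : V3) 1) :
    (cx.1 + ⟪cx.2.1, v - ⟪v - w, (ω : V3)⟫_ℝ • (ω : V3)⟫_ℝ +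
        cx.2.2 * ‖v - ⟪v - w, (ω : V3)⟫_ℝ • (ω : V3)‖ ^ 2 / 2) +
      (cy.1 + ⟪cy.2.1, w + ⟪v - w, (ω : V3)⟫_ℝ • (ω : V3)⟫_ℝ +
        cy.2.2 * ‖w + ⟪v - w, (ω : V3)⟫_ℝ • (ω : V3)‖ ^ 2 / 2) -
      (cx.1 + ⟪cx.2.1, v⟫_ℝ + cx.2.2 * ‖v‖ ^ 2 / 2) - (cy.1 + ⟪cy.2.1, w⟫_ℝ + cy.2.2 * ‖w‖ ^ 2 / 2) =
    ⟪cy.2.1 - cx.2.1, (ω : V3)⟫_ℝ * ⟪v - w, (ω : V3)⟫_ℝ +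
      (cy.2.2 - cx.2.2) / 2 * (⟪v, (ω : V3)⟫_ℝ ^ 2 - ⟪w, (ω : V3)⟫_ℝ ^ 2) := by
  have hω : ‖(ω : V3)‖ = 1 := norm_eq_of_mem_sphere ω
  have hωω : ⟪(ω : V3), (ω : V3)⟫_ℝ = 1 := by
    rw [real_inner_self_eq_norm_sq, hω, one_pow]
  set q : ℝ := ⟪v - w, (ω : V3)⟫_ℝ with hq
  have hq' : q = ⟪v, (ω : V3)⟫_ℝ - ⟪w, (ω : V3)⟫_ℝ := by rw [hq, inner_sub_left]
  have h1 : ‖v - q • (ω : V3)‖ ^ 2 = ‖v‖ ^ 2 - 2 * q * ⟪v, (ω : V3)⟫_ℝ + q ^ 2 := by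
    rw [norm_sub_sq_real, norm_smul, hω, mul_one, Real.norm_eq_abs, sq_abs, inner_smul_right]
    ring
  have h2 : ‖w + q • (ω : V3)‖ ^ 2 = ‖w‖ ^ 2 + 2 * q * ⟪w, (ω : V3)⟫_ℝ + q ^ 2 := by
    rw [norm_add_sq_real, norm_smul, hω, mul_one, Real.norm_eq_abs, sq_abs, inner_smul_right]
    ring
  rw [inner_sub_right, inner_add_right, inner_smul_right, inner_smul_right, h1, h2, inner_sub_left,
    hq']
  ring

section Integral

variable {Y₀ ρ₀ : ℝ} {P₂ P₃ : ℝ → ℝ}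

/-- **The `w`-integral of the quadratic increment.** With the marginal identities
`∫ q₊ q M dw = P₂(⟪v,ω⟫)` and `∫ q₊ (⟪v,ω⟫² − ⟪w,ω⟫²) M dw = P₃(⟪v,ω⟫)` (`q = ⟪v−w,ω⟫`,
`M = globalMaxwellian`) and the integrability of `q₊(1+|w|²)M`:
`∫ q₊ Y₀ (ρ₀ M) Δψ dw = Y₀ ρ₀ (⟪β_y − β_x, ω⟫ P₂(⟪v,ω⟫) + (γ_y − γ_x)/2 · P₃(⟪v,ω⟫))`.
[cite: CIP1994, §3.1] -/
theorem k2r_ref_psi_bracket_integral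
    (hint : ∀ (ω : sphere (0 : V3) 1) (v : V3), Integrable fun w : V3 =>
      max ⟪v - w, (ω : V3)⟫_ℝ 0 * (1 + ‖w‖ ^ 2) * globalMaxwellian w)
    (hP₂ : ∀ (ω : sphere (0 : V3) 1) (v : V3),
      ∫ w : V3, max ⟪v - w, (ω : V3)⟫_ℝ 0 * ⟪v - w, (ω : V3)⟫_ℝ * globalMaxwellian w = P₂ ⟪v, (ω : V3)⟫_ℝ)
    (hP₃ : ∀ (ω : sphere (0 : V3) 1) (v : V3),
      ∫ w : V3, max ⟪v - w, (ω : V3)⟫_ℝ 0 * (⟪v, (ω : V3)⟫_ℝ ^ 2 - ⟪w, (ω : V3)⟫_ℝ ^ 2) *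
        globalMaxwellian w = P₃ ⟪v, (ω : V3)⟫_ℝ)
    (cx cy : ℝ × V3 × ℝ) (v : V3) (ω : sphere (0 : V3) 1) :
    ∫ w : V3, max ⟪v - w, (ω : V3)⟫_ℝ 0 * Y₀ * (ρ₀ * globalMaxwellian w) *
        ((cx.1 + ⟪cx.2.1, v - ⟪v - w, (ω : V3)⟫_ℝ • (ω : V3)⟫_ℝ +
            cx.2.2 * ‖v - ⟪v - w, (ω : V3)⟫_ℝ • (ω : V3)‖ ^ 2 / 2) +
          (cy.1 + ⟪cy.2.1, w + ⟪v - w, (ω : V3)⟫_ℝ • (ω : V3)⟫_ℝ +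
            cy.2.2 * ‖w + ⟪v - w, (ω : V3)⟫_ℝ • (ω : V3)‖ ^ 2 / 2) -
          (cx.1 + ⟪cx.2.1, v⟫_ℝ + cx.2.2 * ‖v‖ ^ 2 / 2) - (cy.1 + ⟪cy.2.1, w⟫_ℝ + cy.2.2 * ‖w‖ ^ 2 / 2)) =
      Y₀ * ρ₀ * (⟪cy.2.1 - cx.2.1, (ω : V3)⟫_ℝ * P₂ ⟪v, (ω : V3)⟫_ℝ +
        (cy.2.2 - cx.2.2) / 2 * P₃ ⟪v, (ω : V3)⟫_ℝ) := by
  have hω : ‖(ω : V3)‖ = 1 := norm_eq_of_mem_sphere ω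
  -- rewrite the increment
  have hincr := fun w : V3 => k2r_ref_psi_increment cx cy v w ω
  simp_rw [hincr]
  -- the two pieces are integrable: `|q| ≤ ‖v‖ + ‖w‖`, `|a² − b²| ≤ ‖v‖² + ‖w‖²`
  have hq_le : ∀ w : V3, |⟪v - w, (ω : V3)⟫_ℝ| ≤ (1 + ‖v‖) * (1 + ‖w‖ ^ 2) := by
    intro w
    calc |⟪v - w, (ω : V3)⟫_ℝ| ≤ ‖v - w‖ * ‖(ω : V3)‖ := abs_real_inner_le_norm _ _
      _ ≤ ‖v‖ + ‖w‖ := by rw [hω, mul_one]; exact norm_sub_le _ _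
      _ ≤ (1 + ‖v‖) * (1 + ‖w‖ ^ 2) := by nlinarith [norm_nonneg v, norm_nonneg w, sq_nonneg (‖w‖ - 1)]
  have hab_le : ∀ w : V3, |⟪v, (ω : V3)⟫_ℝ ^ 2 - ⟪w, (ω : V3)⟫_ℝ ^ 2| ≤ (1 + ‖v‖ ^ 2) * (1 + ‖w‖ ^ 2) := by
    intro w
    have ha : |⟪v, (ω : V3)⟫_ℝ| ≤ ‖v‖ := by
      simpa [hω] using abs_real_inner_le_norm v (ω : V3)
    have hb : |⟪w, (ω : V3)⟫_ℝ| ≤ ‖w‖ := by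
      simpa [hω] using abs_real_inner_le_norm w (ω : V3)
    have ha2 : ⟪v, (ω : V3)⟫_ℝ ^ 2 ≤ ‖v‖ ^ 2 := by
      have := sq_abs ⟪v, (ω : V3)⟫_ℝ; nlinarith [abs_nonneg ⟪v, (ω : V3)⟫_ℝ]
    have hb2 : ⟪w, (ω : V3)⟫_ℝ ^ 2 ≤ ‖w‖ ^ 2 := by
      have := sq_abs ⟪w, (ω : V3)⟫_ℝ; nlinarith [abs_nonneg ⟪w, (ω : V3)⟫_ℝ]
    rw [abs_le]
    constructor <;> nlinarith [sq_nonneg ⟪v, (ω : V3)⟫_ℝ, sq_nonneg ⟪w, (ω : V3)⟫_ℝ,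
      sq_nonneg ‖v‖, sq_nonneg ‖w‖]
  have hM0 : ∀ w : V3, 0 ≤ globalMaxwellian w := fun w => (globalMaxwellian_pos w).le
  have hmeas_q : Continuous fun w : V3 => ⟪v - w, (ω : V3)⟫_ℝ :=
    (continuous_const.sub continuous_id).inner continuous_const
  have hmeas_M : Continuous (globalMaxwellian : V3 → ℝ) := by
    unfold globalMaxwellian; fun_prop
  have hI₂ : Integrable fun w : V3 =>
      max ⟪v - w, (ω : V3)⟫_ℝ 0 * ⟪v - w, (ω : V3)⟫_ℝ * globalMaxwellian w := by
    refine ((hint ω v).const_mul (1 + ‖v‖)).mono' ?_ (Eventually.of_forall fun w => ?_)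
    · exact (((hmeas_q.max continuous_const).mul hmeas_q).mul hmeas_M).aestronglyMeasurable
    · rw [Real.norm_eq_abs, abs_mul, abs_mul, abs_of_nonneg (le_max_right _ _), abs_of_nonneg (hM0 w)]
      calc max ⟪v - w, (ω : V3)⟫_ℝ 0 * |⟪v - w, (ω : V3)⟫_ℝ| * globalMaxwellian w
          ≤ max ⟪v - w, (ω : V3)⟫_ℝ 0 * ((1 + ‖v‖) * (1 + ‖w‖ ^ 2)) * globalMaxwellian w :=
            mul_le_mul_of_nonneg_right
              (mul_le_mul_of_nonneg_left (hq_le w) (le_max_right _ _)) (hM0 w)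
        _ = (1 + ‖v‖) * (max ⟪v - w, (ω : V3)⟫_ℝ 0 * (1 + ‖w‖ ^ 2) * globalMaxwellian w) := by ring
  have hI₃ : Integrable fun w : V3 =>
      max ⟪v - w, (ω : V3)⟫_ℝ 0 * (⟪v, (ω : V3)⟫_ℝ ^ 2 - ⟪w, (ω : V3)⟫_ℝ ^ 2) * globalMaxwellian w := by
    refine ((hint ω v).const_mul (1 + ‖v‖ ^ 2)).mono' ?_ (Eventually.of_forall fun w => ?_)
    · have hb : Continuous fun w : V3 => ⟪w, (ω : V3)⟫_ℝ := continuous_id.inner continuous_const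
      exact (((hmeas_q.max continuous_const).mul (continuous_const.sub (hb.pow 2))).mul
        hmeas_M).aestronglyMeasurable
    · rw [Real.norm_eq_abs, abs_mul, abs_mul, abs_of_nonneg (le_max_right _ _), abs_of_nonneg (hM0 w)]
      calc max ⟪v - w, (ω : V3)⟫_ℝ 0 * |⟪v, (ω : V3)⟫_ℝ ^ 2 - ⟪w, (ω : V3)⟫_ℝ ^ 2| * globalMaxwellian w
          ≤ max ⟪v - w, (ω : V3)⟫_ℝ 0 * ((1 + ‖v‖ ^ 2) * (1 + ‖w‖ ^ 2)) * globalMaxwellian w :=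
            mul_le_mul_of_nonneg_right
              (mul_le_mul_of_nonneg_left (hab_le w) (le_max_right _ _)) (hM0 w)
        _ = (1 + ‖v‖ ^ 2) * (max ⟪v - w, (ω : V3)⟫_ℝ 0 * (1 + ‖w‖ ^ 2) * globalMaxwellian w) := by ring
  -- split the integral
  have hsplit : ∀ w : V3, max ⟪v - w, (ω : V3)⟫_ℝ 0 * Y₀ * (ρ₀ * globalMaxwellian w) *
      (⟪cy.2.1 - cx.2.1, (ω : V3)⟫_ℝ * ⟪v - w, (ω : V3)⟫_ℝ +
        (cy.2.2 - cx.2.2) / 2 * (⟪v, (ω : V3)⟫_ℝ ^ 2 - ⟪w, (ω : V3)⟫_ℝ ^ 2)) =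
      (Y₀ * ρ₀ * ⟪cy.2.1 - cx.2.1, (ω : V3)⟫_ℝ) *
          (max ⟪v - w, (ω : V3)⟫_ℝ 0 * ⟪v - w, (ω : V3)⟫_ℝ * globalMaxwellian w) +
        (Y₀ * ρ₀ * ((cy.2.2 - cx.2.2) / 2)) *
          (max ⟪v - w, (ω : V3)⟫_ℝ 0 * (⟪v, (ω : V3)⟫_ℝ ^ 2 - ⟪w, (ω : V3)⟫_ℝ ^ 2) *
            globalMaxwellian w) := by
    intro w; ring
  simp_rw [hsplit]
  rw [integral_add (hI₂.const_mul _) (hI₃.const_mul _), integral_const_mul, integral_const_mul,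
    hP₂ ω v, hP₃ ω v]
  ring

/-- **Lipschitz bound of the `w`-integral of the quadratic increment.** If the coefficient triples are at
sup-distance `dist cx cy ≤ D`, then `|∫ q₊ Y₀ (ρ₀ M) Δψ dw| ≤ |Y₀ρ₀| D (|P₂(⟪v,ω⟫)| + |P₃(⟪v,ω⟫)|/2)`.
[cite: CIP1994, §3.1] -/
theorem k2r_ref_psi_bracket_abs_le
    (hint : ∀ (ω : sphere (0 : V3) 1) (v : V3), Integrable fun w : V3 =>
      max ⟪v - w, (ω : V3)⟫_ℝ 0 * (1 + ‖w‖ ^ 2) * globalMaxwellian w)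
    (hP₂ : ∀ (ω : sphere (0 : V3) 1) (v : V3),
      ∫ w : V3, max ⟪v - w, (ω : V3)⟫_ℝ 0 * ⟪v - w, (ω : V3)⟫_ℝ * globalMaxwellian w = P₂ ⟪v, (ω : V3)⟫_ℝ)
    (hP₃ : ∀ (ω : sphere (0 : V3) 1) (v : V3),
      ∫ w : V3, max ⟪v - w, (ω : V3)⟫_ℝ 0 * (⟪v, (ω : V3)⟫_ℝ ^ 2 - ⟪w, (ω : V3)⟫_ℝ ^ 2) *
        globalMaxwellian w = P₃ ⟪v, (ω : V3)⟫_ℝ)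
    {cx cy : ℝ × V3 × ℝ} {D : ℝ} (hD : dist cx cy ≤ D) (v : V3) (ω : sphere (0 : V3) 1) :
    |∫ w : V3, max ⟪v - w, (ω : V3)⟫_ℝ 0 * Y₀ * (ρ₀ * globalMaxwellian w) *
        ((cx.1 + ⟪cx.2.1, v - ⟪v - w, (ω : V3)⟫_ℝ • (ω : V3)⟫_ℝ +
            cx.2.2 * ‖v - ⟪v - w, (ω : V3)⟫_ℝ • (ω : V3)‖ ^ 2 / 2) +
          (cy.1 + ⟪cy.2.1, w + ⟪v - w, (ω : V3)⟫_ℝ • (ω : V3)⟫_ℝ +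
            cy.2.2 * ‖w + ⟪v - w, (ω : V3)⟫_ℝ • (ω : V3)‖ ^ 2 / 2) -
          (cx.1 + ⟪cx.2.1, v⟫_ℝ + cx.2.2 * ‖v‖ ^ 2 / 2) - (cy.1 + ⟪cy.2.1, w⟫_ℝ + cy.2.2 * ‖w‖ ^ 2 / 2))| ≤
      |Y₀ * ρ₀| * D * (|P₂ ⟪v, (ω : V3)⟫_ℝ| + |P₃ ⟪v, (ω : V3)⟫_ℝ| / 2) := by
  rw [k2r_ref_psi_bracket_integral hint hP₂ hP₃ cx cy v ω]
  have hω : ‖(ω : V3)‖ = 1 := norm_eq_of_mem_sphere ω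
  have hD0 : 0 ≤ D := dist_nonneg.trans hD
  have hβ : ‖cy.2.1 - cx.2.1‖ ≤ D := by
    calc ‖cy.2.1 - cx.2.1‖ = ‖(cy - cx).2.1‖ := by rfl
      _ ≤ ‖(cy - cx).2‖ := norm_fst_le _
      _ ≤ ‖cy - cx‖ := norm_snd_le _
      _ = dist cx cy := by rw [dist_comm, dist_eq_norm]
      _ ≤ D := hD
  have hγ : |cy.2.2 - cx.2.2| ≤ D := by
    calc |cy.2.2 - cx.2.2| = ‖(cy - cx).2.2‖ := by rfl
      _ ≤ ‖(cy - cx).2‖ := norm_snd_le _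
      _ ≤ ‖cy - cx‖ := norm_snd_le _
      _ = dist cx cy := by rw [dist_comm, dist_eq_norm]
      _ ≤ D := hD
  have hinner : |⟪cy.2.1 - cx.2.1, (ω : V3)⟫_ℝ| ≤ D := by
    calc |⟪cy.2.1 - cx.2.1, (ω : V3)⟫_ℝ| ≤ ‖cy.2.1 - cx.2.1‖ * ‖(ω : V3)‖ := abs_real_inner_le_norm _ _
      _ ≤ D := by rw [hω, mul_one]; exact hβ
  rw [abs_mul, mul_assoc (|Y₀ * ρ₀|)]
  refine mul_le_mul_of_nonneg_left ?_ (abs_nonneg _)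
  calc |⟪cy.2.1 - cx.2.1, (ω : V3)⟫_ℝ * P₂ ⟪v, (ω : V3)⟫_ℝ + (cy.2.2 - cx.2.2) / 2 * P₃ ⟪v, (ω : V3)⟫_ℝ|
      ≤ |⟪cy.2.1 - cx.2.1, (ω : V3)⟫_ℝ * P₂ ⟪v, (ω : V3)⟫_ℝ| + |(cy.2.2 - cx.2.2) / 2 * P₃ ⟪v, (ω : V3)⟫_ℝ| :=
        abs_add_le _ _
    _ = |⟪cy.2.1 - cx.2.1, (ω : V3)⟫_ℝ| * |P₂ ⟪v, (ω : V3)⟫_ℝ| +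
          |cy.2.2 - cx.2.2| / 2 * |P₃ ⟪v, (ω : V3)⟫_ℝ| := by
        rw [abs_mul, abs_mul, abs_div, abs_two]
    _ ≤ D * |P₂ ⟪v, (ω : V3)⟫_ℝ| + D / 2 * |P₃ ⟪v, (ω : V3)⟫_ℝ| := by
        gcongr
    _ = D * (|P₂ ⟪v, (ω : V3)⟫_ℝ| + |P₃ ⟪v, (ω : V3)⟫_ℝ| / 2) := by ring

/-- **Size of `L ψ` on a velocity ball: `O(λ ε)`.** For a coefficient field `cc : 𝕋³ → ℝ × ℝ³ × ℝ`
that is `C`-Lipschitz for the sup-distance, the partner point `x + εω` (`|ε|`-close to `x` on `𝕋³`),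
and bounds `|P₂| ≤ B₂`, `|P₃| ≤ B₃` on `[-V, V]`: for `‖v‖ ≤ V`,
`|λ ∫_{S²} ∫ q₊ Y₀ (ρ₀M) Δψ dw dσ| ≤ |λ| · 4π · |Y₀ρ₀| · C|ε| · (B₂ + B₃/2)`. [cite: CIP1994, §3.1] -/
theorem k2r_ref_psi_operator_abs_le
    (hint : ∀ (ω : sphere (0 : V3) 1) (v : V3), Integrable fun w : V3 =>
      max ⟪v - w, (ω : V3)⟫_ℝ 0 * (1 + ‖w‖ ^ 2) * globalMaxwellian w)
    (hP₂ : ∀ (ω : sphere (0 : V3) 1) (v : V3),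
      ∫ w : V3, max ⟪v - w, (ω : V3)⟫_ℝ 0 * ⟪v - w, (ω : V3)⟫_ℝ * globalMaxwellian w = P₂ ⟪v, (ω : V3)⟫_ℝ)
    (hP₃ : ∀ (ω : sphere (0 : V3) 1) (v : V3),
      ∫ w : V3, max ⟪v - w, (ω : V3)⟫_ℝ 0 * (⟪v, (ω : V3)⟫_ℝ ^ 2 - ⟪w, (ω : V3)⟫_ℝ ^ 2) *
        globalMaxwellian w = P₃ ⟪v, (ω : V3)⟫_ℝ)
    {cc : T3 → ℝ × V3 × ℝ} {C : ℝ} (hC : 0 ≤ C) (hLip : ∀ x y, dist (cc x) (cc y) ≤ C * dist x y)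
    {V B₂ B₃ : ℝ} (hB₂ : ∀ a, |a| ≤ V → |P₂ a| ≤ B₂) (hB₃ : ∀ a, |a| ≤ V → |P₃ a| ≤ B₃)
    (lam ε : ℝ) (x : T3) {v : V3} (hv : ‖v‖ ≤ V) :
    |lam * ∫ ω : sphere (0 : V3) 1, (∫ w : V3, max ⟪v - w, (ω : V3)⟫_ℝ 0 * Y₀ * (ρ₀ * globalMaxwellian w) *
        (((cc x).1 + ⟪(cc x).2.1, v - ⟪v - w, (ω : V3)⟫_ℝ • (ω : V3)⟫_ℝ +
            (cc x).2.2 * ‖v - ⟪v - w, (ω : V3)⟫_ℝ • (ω : V3)‖ ^ 2 / 2) +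
          ((cc (x + Torus.proj (ε • (ω : V3)))).1 +
            ⟪(cc (x + Torus.proj (ε • (ω : V3)))).2.1, w + ⟪v - w, (ω : V3)⟫_ℝ • (ω : V3)⟫_ℝ +
            (cc (x + Torus.proj (ε • (ω : V3)))).2.2 * ‖w + ⟪v - w, (ω : V3)⟫_ℝ • (ω : V3)‖ ^ 2 / 2) -
          ((cc x).1 + ⟪(cc x).2.1, v⟫_ℝ + (cc x).2.2 * ‖v‖ ^ 2 / 2) -
          ((cc (x + Torus.proj (ε • (ω : V3)))).1 + ⟪(cc (x + Torus.proj (ε • (ω : V3)))).2.1, w⟫_ℝ +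
            (cc (x + Torus.proj (ε • (ω : V3)))).2.2 * ‖w‖ ^ 2 / 2))) ∂sphereMeasure| ≤
      |lam| * (4 * Real.pi) * (|Y₀ * ρ₀| * (C * |ε|) * (B₂ + B₃ / 2)) := by
  haveI : IsFiniteMeasure (sphereMeasure : Measure (sphere (0 : V3) 1)) := by
    unfold sphereMeasure; infer_instance
  rw [abs_mul, mul_assoc (|lam|)]
  refine mul_le_mul_of_nonneg_left ?_ (abs_nonneg _)
  have hbound : ∀ ω : sphere (0 : V3) 1,
      ‖∫ w : V3, max ⟪v - w, (ω : V3)⟫_ℝ 0 * Y₀ * (ρ₀ * globalMaxwellian w) *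
        (((cc x).1 + ⟪(cc x).2.1, v - ⟪v - w, (ω : V3)⟫_ℝ • (ω : V3)⟫_ℝ +
            (cc x).2.2 * ‖v - ⟪v - w, (ω : V3)⟫_ℝ • (ω : V3)‖ ^ 2 / 2) +
          ((cc (x + Torus.proj (ε • (ω : V3)))).1 +
            ⟪(cc (x + Torus.proj (ε • (ω : V3)))).2.1, w + ⟪v - w, (ω : V3)⟫_ℝ • (ω : V3)⟫_ℝ +
            (cc (x + Torus.proj (ε • (ω : V3)))).2.2 * ‖w + ⟪v - w, (ω : V3)⟫_ℝ • (ω : V3)‖ ^ 2 / 2) -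
          ((cc x).1 + ⟪(cc x).2.1, v⟫_ℝ + (cc x).2.2 * ‖v‖ ^ 2 / 2) -
          ((cc (x + Torus.proj (ε • (ω : V3)))).1 + ⟪(cc (x + Torus.proj (ε • (ω : V3)))).2.1, w⟫_ℝ +
            (cc (x + Torus.proj (ε • (ω : V3)))).2.2 * ‖w‖ ^ 2 / 2))‖ ≤
        |Y₀ * ρ₀| * (C * |ε|) * (B₂ + B₃ / 2) := by
    intro ω
    have hω : ‖(ω : V3)‖ = 1 := norm_eq_of_mem_sphere ω
    have hdist : dist (cc x) (cc (x + Torus.proj (ε • (ω : V3)))) ≤ C * |ε| := by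
      refine (hLip _ _).trans ?_
      have hd : dist x (x + Torus.proj (ε • (ω : V3))) ≤ |ε| := by
        rw [dist_comm]
        refine (k2r_dist_add_proj_le x _).trans ?_
        rw [norm_smul, hω, mul_one, Real.norm_eq_abs]
      exact mul_le_mul_of_nonneg_left hd hC
    have ha : |⟪v, (ω : V3)⟫_ℝ| ≤ V := by
      calc |⟪v, (ω : V3)⟫_ℝ| ≤ ‖v‖ * ‖(ω : V3)‖ := abs_real_inner_le_norm _ _
        _ ≤ V := by rw [hω, mul_one]; exact hv
    rw [Real.norm_eq_abs]
    refine (k2r_ref_psi_bracket_abs_le hint hP₂ hP₃ hdist v ω).trans ?_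
    gcongr
    · exact hB₂ _ ha
    · exact hB₃ _ ha
  calc |∫ ω : sphere (0 : V3) 1, _ ∂sphereMeasure|
      ≤ (|Y₀ * ρ₀| * (C * |ε|) * (B₂ + B₃ / 2)) * (sphereMeasure : Measure (sphere (0 : V3) 1)).real univ := by
        rw [← Real.norm_eq_abs]
        exact norm_integral_le_of_norm_le_const (Eventually.of_forall hbound)
    _ = 4 * Real.pi * (|Y₀ * ρ₀| * (C * |ε|) * (B₂ + B₃ / 2)) := by
        rw [k2r_sphereMeasure_real_univ]; ring

end Integral

/-- Registered sub-goal `stub_refPsiOperator` of the refutation line (keyed theorem of this file): the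
quadratic pair-increment identity `k2r_ref_psi_increment`, closed. [cite: CIP1994, §3.1] -/
theorem stub_refPsiOperator :
    ∀ (cx cy : ℝ × V3 × ℝ) (v w : V3) (ω : sphere (0 : V3) 1),
    (cx.1 + ⟪cx.2.1, v - ⟪v - w, (ω : V3)⟫_ℝ • (ω : V3)⟫_ℝ +
        cx.2.2 * ‖v - ⟪v - w, (ω : V3)⟫_ℝ • (ω : V3)‖ ^ 2 / 2) +
      (cy.1 + ⟪cy.2.1, w + ⟪v - w, (ω : V3)⟫_ℝ • (ω : V3)⟫_ℝ +
        cy.2.2 * ‖w + ⟪v - w, (ω : V3)⟫_ℝ • (ω : V3)‖ ^ 2 / 2) -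
      (cx.1 + ⟪cx.2.1, v⟫_ℝ + cx.2.2 * ‖v‖ ^ 2 / 2) - (cy.1 + ⟪cy.2.1, w⟫_ℝ + cy.2.2 * ‖w‖ ^ 2 / 2) =
    ⟪cy.2.1 - cx.2.1, (ω : V3)⟫_ℝ * ⟪v - w, (ω : V3)⟫_ℝ +
      (cy.2.2 - cx.2.2) / 2 * (⟪v, (ω : V3)⟫_ℝ ^ 2 - ⟪w, (ω : V3)⟫_ℝ ^ 2) :=
  k2r_ref_psi_increment

end Summit.AtomisticToContinuum.HydrodynamicLimit.Theorems.EnskogAdjointDuality
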